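import Summits.ABC.StewartYu.PadicG3TwoFrameSat
import Summits.ABC.StewartYu.SatFrameKit
import Literature.NumberTheory.EllipticCurves.Wiles2000CongruentProofs
import HarnessLib

/-!
# Cell abc-stewartyu, WP-L.P(2) (crux r4 `PadicCoreTwoRat`, stmt-ABC-20504), TOP ASSEMBLY: the Kummer-free frame
# `FrameTwoRat C (d+1)` from a REDUCED SATURATED BASIS KIT and the RECORD'S SUPPLY — the crux datum ↦ `(S, F)` construction

`Summits/ABC/StewartYu/PadicG3TwoFrameSatData.lean` — cell `abc-stewartyu` (HOME `run/shared/lean/pub/abc-stewartyu/`), route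
`YuMatveevShapeRat`, seat p3 (g9, WP-L.P(2) lead; design memo HOME/p3/memo-11 §1 (M1), §2 rows «𝔑 set-up» / «assembly»).  Three
definitions (the kit predicate `SatKitFull`, the saturation datum `satDataOf`, the record interface `RecordSupplyTwoSat`) and theorems.

* **`SatKitFull n`** — the REDUCED SATURATED BASIS KIT (p2-g6's `SatKit n` text of 2026-08-27 16:22Z with the Kummer line stated as
  FULL saturation up to sign, as `Dioph.exists_saturated_basis_rat`): for positive independent `a : Fin n → ℚ`, a positive independent
  saturated basis `θ` with `θᵢ^N = ∏ aⱼ^{Uᵢⱼ}`, `aⱼ = ∏ θᵢ^{Cⱼᵢ}`, `U·C = C·U = N•1`, `N ≤ ∏ 2·max(1,h(aⱼ))/log 2` and the three SIZE lines of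
  a Hermite-reduced basis (`Σᵢ|Uᵢⱼ| ≤ n·N`, `|Cⱼₖ| ≤ n!·N`, `h(θᵢ) ≤ Σⱼ max(1,h(aⱼ))`).  The algebraic lines are `SatFrameKit.exists_satFrame`;
  the size lines are p1's `SatBasisReduced` (R25 (3)) — NOT proved here;
* `satDataOf` — the `SatData` of the pivot-last set-up `TwoSetup.ofData d ϑ (b ᵥ* C) …` with `αo = α²`;
* **`RecordSupplyTwoSat C d`** — the RECORD'S SUPPLY for the 𝔑-threaded `2`-adic frame at rank `d + 1`: for every crux datum under
  the negated bound and every pivot-last saturated presentation (`ϑ`, `C`, `U`, `N`, `Ucol` with their identities and size lines),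
  a schedule with `FrameNumericsTwoRASat`, the slab depth from the negated bound, the END ranges and `RecordTwo C (d+1) V Vmax W …`
  VERBATIM (records seat p1: `parTwoN`);
* **`frameTwoRat_of_recordSat`** — `SatKitFull (d+1) → RecordSupplyTwoSat C d → FrameTwoRat C (d+1)`: kit on `|α|`, square
  (`ϑ := θ²`: `≡ 1 (mod 8)`, `3`-Kummer from saturation), transport `b̃ = b ᵥ* C`, permute the coordinate of `b̃` of minimal `2`-adic
  order to the last place, run `frameOutputReal_of_numericsRASat` at `ξⱼ = (αⱼ²)^{1/N}` (independent units by
  `GenThreeEndReal.hind_units_of_rpow_rat`), pick any `j₀` with `b j₀ ≠ 0`.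

WHAT THIS IS NOT: no proof of `SatKitFull` (lattice kit), no record (`RecordSupplyTwoSat` is p1's); no crux moves (A1.L not moved).

References: Yu. V. Nesterenko, LNM 1819 (2003), §3.5, §4.3 Cor 4.5, §5; K. Yu, Acta Math. 211 (2013), §1.1 p.319, §6; HOME/p3/memo-11.
-/

noncomputable section

open Finset Polynomial
open scoped Matrix Nat
open Literature.NumberTheory.Transcendental
open Literature.NumberTheory.Transcendental (FeldmanDelta.den)
open Literature.NumberTheory.Transcendental.CW77.Setup (Tau tauNorm)

namespace Summit.ABC.StewartYu

/-! ### The reduced saturated basis kit (both parities) -/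

/-- **The reduced saturated basis kit at rank `n`** (= p2-g6's `SatKit n` with the Kummer line as full saturation): for positive
multiplicatively independent `a`, a positive independent basis `θ` of the saturation of `⟨a⟩`, saturated up to sign for every
exponent `q ≥ 1`, with `θᵢ^N = ∏ aⱼ^{Uᵢⱼ}`, `aⱼ = ∏ θᵢ^{Cⱼᵢ}`, `U·C = C·U = N•1`, the index bound `N ≤ ∏ 2·max(1,h(aⱼ))/log 2`, and
the size lines of a Hermite-reduced basis. [cite: Nesterenko2003, §3.5 (p.105) and §4.3 Cor 4.5; shape only] -/
def SatKitFull (n : ℕ) : Prop :=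
  ∀ a : Fin n → ℚ, (∀ j, 0 < a j) → (∀ μ : Fin n → ℤ, ∏ j, a j ^ μ j = 1 → μ = 0) →
    ∃ (θ : Fin n → ℚ) (U C : Matrix (Fin n) (Fin n) ℤ) (N : ℕ),
      (∀ i, 0 < θ i) ∧
      (∀ μ : Fin n → ℤ, ∏ i, θ i ^ μ i = 1 → μ = 0) ∧
      (∀ q : ℕ, 0 < q → ∀ γ : ℚ, (∃ c : Fin n → ℤ, γ ^ q = ∏ i, θ i ^ c i) →
        ∃ c : Fin n → ℤ, γ = ∏ i, θ i ^ c i ∨ -γ = ∏ i, θ i ^ c i) ∧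
      0 < N ∧ (∀ i, θ i ^ N = ∏ j, a j ^ U i j) ∧ (∀ j, a j = ∏ i, θ i ^ C j i) ∧
      U * C = (N : ℤ) • (1 : Matrix (Fin n) (Fin n) ℤ) ∧ C * U = (N : ℤ) • (1 : Matrix (Fin n) (Fin n) ℤ) ∧
      (N : ℝ) ≤ ∏ j, (2 * max 1 (Height.logHeight₁ (a j)) / Real.log 2) ∧
      (∀ j, ∑ i, |U i j| ≤ (n : ℤ) * N) ∧ (∀ j k, |C j k| ≤ ((n ! : ℕ) : ℤ) * N) ∧
      (∀ i, Height.logHeight₁ (θ i) ≤ ∑ j, max 1 (Height.logHeight₁ (a j)))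

namespace TwoSetup

open Summit.ABC.StewartYu.G3Boxes

/-! ### The saturation datum of the pivot-last set-up -/

/-- **The saturation datum of `ofData`**: generators `ϑ` (positive, tied to `αo` by `ϑₖ^N = ∏ αoⱼ^{U k j}`).
[cite: Nesterenko2003, §3.5; shape only] -/
def satDataOf (d : ℕ) (ϑ : Fin (d + 1) → ℚ) (bt : Fin (d + 1) → ℤ)
    (hϑ : ∀ j, 3 ≤ padicValRat 2 (ϑ j - 1)) (hb : bt (Fin.last d) ≠ 0)
    (hmin : ∀ j, bt j ≠ 0 → padicValInt 2 (bt (Fin.last d)) ≤ padicValInt 2 (bt j))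
    (αo : Fin (d + 1) → ℚ) (hαo : ∀ j, 0 < αo j) (hpos : ∀ k, 0 < ϑ k)
    (U : Matrix (Fin (d + 1)) (Fin (d + 1)) ℤ) (N : ℕ) (hN : 0 < N) (hU : ∀ k, ϑ k ^ N = ∏ j, αo j ^ U k j) :
    (ofData d ϑ bt hϑ hb hmin).SatData where
  αo := αo
  hαo := hαo
  hall := by intro i; rw [ofData_all]; exact hpos i
  U := U
  N := N
  hN := hN
  hU := by intro i; rw [ofData_all]; exact hU i

/-! ### The record's supply -/

/-- **THE RECORD'S SUPPLY FOR THE 𝔑-THREADED `2`-ADIC FRAME at rank `d + 1`**: for every crux datum `(α, b, V, Vmax, W)` under the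
negated bound and every PIVOT-LAST saturated presentation — generators `ϑ ≡ 1 (mod 8)`, `α² = ϑ^C`, `ϑ^N = (α²)^U`, `U·C = C·U = N•1`,
transported coefficients `b ᵥ* C` with the last one non-zero of minimal `2`-adic order, index bound and size lines — a schedule `σ`
with the complete obligation list `FrameNumericsTwoRASat`, the slab depth `‖Λ₀‖ ≤ 2^{−(m+3)}` from the negated bound, the END
ranges, and `RecordTwo C (d+1) V Vmax W D₀' S₀ X D'` VERBATIM for bounds `D₀' ≥ D₀`, `D' ≥ Bv I*`.
[cite: Yu2013, §3.1, §6; Nesterenko2003, §5.2 (5.14)–(5.22); shape only] -/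
def RecordSupplyTwoSat (C : ℕ → ℝ) (d : ℕ) : Prop :=
  ∀ (α : Fin (d + 1) → ℚ) (b : Fin (d + 1) → ℤ) (V : Fin (d + 1) → ℝ) (Vmax W : ℝ),
    (∀ j, 3 ≤ padicValRat 2 (α j - 1)) →
    (∀ μ : Fin (d + 1) → ℤ, ∏ j, α j ^ μ j = 1 → μ = 0) →
    (∀ j, Height.logHeight₁ (α j) ≤ V j) → (∀ j, 1 ≤ V j) → (∀ j, V j ≤ Vmax) →
    b ≠ 0 → (∀ j, Real.log (max 3 (|b j| : ℝ)) ≤ W) → 1 ≤ W →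
    ¬ (padicValRat 2 (∏ j, α j ^ b j - 1) : ℝ) ≤ C (d + 1) * (∏ j, V j) * (W + Real.log (2 * Vmax)) →
    ∀ (ϑ : Fin (d + 1) → ℚ) (Cm U : Matrix (Fin (d + 1)) (Fin (d + 1)) ℤ) (N : ℕ) (Ucol : Fin (d + 1) → ℕ)
      (hϑ : ∀ k, 3 ≤ padicValRat 2 (ϑ k - 1))
      (hlast : (b ᵥ* Cm) (Fin.last d) ≠ 0)
      (hmin : ∀ k, (b ᵥ* Cm) k ≠ 0 → padicValInt 2 ((b ᵥ* Cm) (Fin.last d)) ≤ padicValInt 2 ((b ᵥ* Cm) k))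
      (hpos : ∀ k, 0 < ϑ k) (hN : 0 < N) (hU : ∀ k, ϑ k ^ N = ∏ j, (α j ^ 2) ^ U k j)
      (hα2 : ∀ j, (0 : ℚ) < α j ^ 2),
      (∀ μ : Fin (d + 1) → ℤ, ∏ k, ϑ k ^ μ k = 1 → μ = 0) →
      (∀ j, α j ^ 2 = ∏ k, ϑ k ^ Cm j k) →
      U * Cm = (N : ℤ) • (1 : Matrix (Fin (d + 1)) (Fin (d + 1)) ℤ) →
      Cm * U = (N : ℤ) • (1 : Matrix (Fin (d + 1)) (Fin (d + 1)) ℤ) →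
      (N : ℝ) ≤ ∏ j, (2 * max 1 (Height.logHeight₁ (α j)) / Real.log 2) →
      (∀ j, ∑ k, |U k j| ≤ (Ucol j : ℤ)) → (∀ j, (Ucol j : ℤ) ≤ (d + 1 : ℕ) * N) →
      (∀ j k, |Cm j k| ≤ (((d + 1) ! : ℕ) : ℤ) * N) →
      (∀ k, Height.logHeight₁ (ϑ k) ≤ 2 * ∑ j, max 1 (Height.logHeight₁ (α j))) →
      ∃ (σ : (ofData d ϑ (b ᵥ* Cm) hϑ hlast hmin).G3TwoSched) (Bv : ℕ → Fin (d + 1) → ℕ)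
        (Bv₀ : Fin (d + 1) → ℕ) (H L₀ : ℕ) (B : Finset (ℕ × ((Fin d → ℤ) × ℤ))) (S₀ X D₀' : ℕ)
        (D' : Fin (d + 1) → ℕ),
        FrameNumericsTwoRASat σ
          (satDataOf d ϑ (b ᵥ* Cm) hϑ hlast hmin (fun j => α j ^ 2) hα2 hpos U N hN hU) Bv Bv₀ Ucol H L₀ B ∧
        ‖(ofData d ϑ (b ᵥ* Cm) hϑ hlast hmin).Λ₀‖ ≤ ((2 : ℝ) ^ (σ.m + 3))⁻¹ ∧
        (d + 1 + 1) * X ≤ σ.Nfin σ.Istar ∧ (d + 1 + 1) * S₀ < σ.Tfin σ.Istar ∧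
        σ.D₀ ≤ D₀' ∧ (∀ j, Bv σ.Istar j ≤ D' j) ∧
        GenThreeFrameSpecTwo.RecordTwo C (d + 1) V Vmax W D₀' S₀ X D'

/-! ### The frame from the kit and the record -/

/-- Entry `(k, k')` of `(U.submatrix e id) * (C.submatrix id e)` is entry `(e k, e k')` of `U * C`. [folklore] -/
theorem submatrix_mul_submatrix_apply {n : ℕ} (U Cm : Matrix (Fin n) (Fin n) ℤ) (e : Equiv.Perm (Fin n)) (k k' : Fin n) :
    (Matrix.of (fun k j => U (e k) j) * Matrix.of (fun j k => Cm j (e k))) k k' = (U * Cm) (e k) (e k') := by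
  simp only [Matrix.mul_apply, Matrix.of_apply]

/-- Entry `(j, l)` of `(C.submatrix id e) * (U.submatrix e id)` is entry `(j, l)` of `C * U`. [folklore] -/
theorem submatrix_mul_submatrix_apply' {n : ℕ} (U Cm : Matrix (Fin n) (Fin n) ℤ) (e : Equiv.Perm (Fin n)) (j l : Fin n) :
    (Matrix.of (fun j k => Cm j (e k)) * Matrix.of (fun k l => U (e k) l)) j l = (Cm * U) j l := by
  simp only [Matrix.mul_apply, Matrix.of_apply]
  exact Equiv.sum_comp e (fun i => Cm j i * U i l)

/-- **THE KUMMER-FREE `2`-ADIC FRAME at rank `d + 1` from the reduced saturated basis kit and the record's supply.**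
[cite: Yu2007, Main Thm (K = ℚ, ℘ = 2); shape only] [cite: Nesterenko2003, §4.3, §5] -/
theorem frameTwoRat_of_recordSat {C : ℕ → ℝ} {d : ℕ} (hkit : SatKitFull (d + 1)) (hrec : RecordSupplyTwoSat C d) :
    GenThreeFrameSpecTwoRat.FrameTwoRat C (d + 1) := by
  classical
  intro α b V Vmax W hα hind hV hV1 hVmax hb hW hW1 hneg
  haveI : Fact (Nat.Prime 2) := ⟨Nat.prime_two⟩
  have hα0 : ∀ j, α j ≠ 0 := fun j => ne_zero_of_three_le (hα j)
  have hαv : ∀ j, padicValRat 2 (α j) = 0 := fun j => GenThreeInductionTwo.padicValRat_eq_zero_of_three_le (hα j)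
  -- the kit on `|α|`
  have habs : ∀ j, 0 < |α j| := fun j => abs_pos.mpr (hα0 j)
  obtain ⟨θ, U, Cm, N, hθpos, hθind, hsat, hNpos, hUθ, hCθ, hUC, hCU, hNle, hUcol, hCbnd, hhθ⟩ :=
    hkit (fun j => |α j|) habs (SatFrameKit.mulIndep_abs α hind)
  have hθ0 : ∀ i, θ i ≠ 0 := fun i => (hθpos i).ne'
  -- `ϑ := θ²`
  set ϑ : Fin (d + 1) → ℚ := fun i => θ i ^ 2 with hϑdef
  have hϑpos : ∀ i, 0 < ϑ i := fun i => pow_pos (hθpos i) 2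
  have hαv' : ∀ j, padicValRat 2 (|α j|) = 0 := by
    intro j; rcases abs_choice (α j) with h | h
    · rw [h]; exact hαv j
    · rw [h, padicValRat.neg]; exact hαv j
  have hθv : ∀ i, padicValRat 2 (θ i) = 0 := by
    intro i
    have h1 : padicValRat 2 (θ i ^ N) = 0 := by
      rw [hUθ i]; exact SatFrameKit.padicValRat_prod_zpow_eq_zero _ (fun j => (habs j).ne') hαv' _
    exact SatFrameKit.padicValRat_eq_zero_of_pow hNpos.ne' h1
  have hϑ8 : ∀ i, 3 ≤ padicValRat 2 (ϑ i - 1) := by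
    intro i
    have h1 : θ i ^ 2 - 1 ≠ 0 := by
      intro h0
      have hsq : θ i ^ 2 = 1 := sub_eq_zero.mp h0
      have hone : ∏ k, θ k ^ (Pi.single i 2 : Fin (d + 1) → ℤ) k = 1 := by
        rw [Finset.prod_eq_single i (fun k _ hk => by rw [Pi.single_eq_of_ne hk, zpow_zero])
          (fun h => absurd (Finset.mem_univ i) h), Pi.single_eq_same]
        exact_mod_cast hsq
      have := congr_fun (hθind _ hone) i
      simp at this
    exact Literature.NumberTheory.EllipticCurves.Wiles2000.three_le_padicValRat_sq_sub_one (hθ0 i) (hθv i) h1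
  have hϑind : ∀ μ : Fin (d + 1) → ℤ, ∏ i, ϑ i ^ μ i = 1 → μ = 0 := by
    intro μ hμ
    have h2 : ∏ i, θ i ^ (2 * μ i) = 1 := by
      calc ∏ i, θ i ^ (2 * μ i) = ∏ i, (θ i ^ 2) ^ μ i := prod_congr rfl fun i _ => by rw [zpow_mul]; norm_cast
        _ = 1 := hμ
    have := hθind _ h2
    funext i
    have hi := congr_fun this i
    simp only [Pi.zero_apply, mul_eq_zero, OfNat.ofNat_ne_zero, false_or] at hi
    exact hi
  have hsat3 : ∀ γ : ℚ, (∃ c : Fin (d + 1) → ℤ, γ ^ 3 = ∏ i, θ i ^ c i) → ∃ c : Fin (d + 1) → ℤ, γ = ∏ i, θ i ^ c i := by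
    rintro γ ⟨c, hc⟩
    obtain ⟨c', hc' | hc'⟩ := hsat 3 (by norm_num) γ ⟨c, hc⟩
    · exact ⟨c', hc'⟩
    · exfalso
      have hγpos : 0 < γ := by
        have h3 : 0 < γ ^ 3 := by rw [hc]; exact prod_pos fun i _ => zpow_pos (hθpos i) _
        exact (Odd.pow_pos_iff (by decide : Odd 3)).mp h3
      have : 0 < -γ := by rw [hc']; exact prod_pos fun i _ => zpow_pos (hθpos i) _
      linarith
  have hϑK3 : ∀ (κ : Fin (d + 1) → ℤ) (γ : ℚ), ∏ i, ϑ i ^ κ i = γ ^ 3 → ∀ i, (3 : ℤ) ∣ κ i := by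
    intro κ γ h i
    have h2 : ∏ k, θ k ^ (2 * κ k) = γ ^ 3 := by
      calc ∏ k, θ k ^ (2 * κ k) = ∏ k, (θ k ^ 2) ^ κ k := prod_congr rfl fun k _ => by rw [zpow_mul]; norm_cast
        _ = γ ^ 3 := h
    have h3 := Literature.NumberTheory.DiophantineGeometry.KummerSaturated.three_dvd_of_prod_zpow_eq_cube_rat
      hθ0 hθind hsat3 h2 i
    have h32 : IsCoprime (3 : ℤ) 2 := by norm_num [Int.isCoprime_iff_gcd_eq_one]
    exact h32.dvd_of_dvd_mul_left h3
  have hαo : ∀ j, α j ^ 2 = ∏ i, ϑ i ^ Cm j i := by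
    intro j
    rw [SatFrameKit.prod_sq_zpow, ← hCθ j, sq_abs]
  have hUϑ : ∀ i, ϑ i ^ N = ∏ j, (α j ^ 2) ^ U i j := by
    intro i
    calc ϑ i ^ N = (θ i ^ N) ^ 2 := by show (θ i ^ 2) ^ N = _; ring
      _ = (∏ j, |α j| ^ U i j) ^ 2 := by rw [hUθ i]
      _ = ∏ j, (|α j| ^ 2) ^ U i j := (SatFrameKit.prod_sq_zpow _ _).symm
      _ = ∏ j, (α j ^ 2) ^ U i j := prod_congr rfl fun j _ => by rw [sq_abs]
  have hhϑ : ∀ i, Height.logHeight₁ (ϑ i) ≤ 2 * ∑ j, max 1 (Height.logHeight₁ (α j)) := by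
    intro i
    rw [hϑdef]; dsimp only
    rw [Height.logHeight₁_pow]
    have := hhθ i
    have e : ∀ j, Height.logHeight₁ (|α j|) = Height.logHeight₁ (α j) := by
      intro j; rcases abs_choice (α j) with h | h
      · rw [h]
      · rw [h, Height.logHeight₁_neg]
    simp only [e] at this
    push_cast; linarith
  have hNle' : (N : ℝ) ≤ ∏ j, (2 * max 1 (Height.logHeight₁ (α j)) / Real.log 2) := by
    refine hNle.trans (le_of_eq (prod_congr rfl fun j _ => ?_))
    rcases abs_choice (α j) with h | h
    · rw [h]
    · rw [h, Height.logHeight₁_neg]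
  -- `det C ≠ 0`, `b̃ := b ᵥ* C ≠ 0`
  have hNz : ((N : ℤ)) ≠ 0 := by exact_mod_cast hNpos.ne'
  have hdetC : Cm.det ≠ 0 := by
    intro h0
    have := congrArg Matrix.det hUC
    rw [Matrix.det_mul, h0, mul_zero, Matrix.det_smul, Matrix.det_one, mul_one, Fintype.card_fin] at this
    exact pow_ne_zero _ hNz this.symm
  have hbt : b ᵥ* Cm ≠ 0 := SatFrameKit.vecMul_ne_zero_of_det_ne_zero Cm hdetC hb
  -- the pivot: a coordinate of `b̃` of minimal `2`-adic order, swapped to the last place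
  have hne : (Finset.univ.filter fun k => (b ᵥ* Cm) k ≠ 0).Nonempty := by
    by_contra h0
    rw [Finset.not_nonempty_iff_eq_empty, Finset.filter_eq_empty_iff] at h0
    apply hbt; funext k
    have := h0 (Finset.mem_univ k)
    push Not at this
    exact this
  obtain ⟨k₀, hk₀mem, hk₀min⟩ :=
    Finset.exists_min_image (Finset.univ.filter fun k => (b ᵥ* Cm) k ≠ 0) (fun k => padicValInt 2 ((b ᵥ* Cm) k)) hne
  have hbk₀ : (b ᵥ* Cm) k₀ ≠ 0 := (Finset.mem_filter.mp hk₀mem).2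
  set e : Equiv.Perm (Fin (d + 1)) := Equiv.swap (Fin.last d) k₀ with he
  have helast : e (Fin.last d) = k₀ := by rw [he, Equiv.swap_apply_left]
  -- the permuted presentation
  set ϑ' : Fin (d + 1) → ℚ := fun k => ϑ (e k) with hϑ'
  set C' : Matrix (Fin (d + 1)) (Fin (d + 1)) ℤ := Matrix.of fun j k => Cm j (e k) with hC'
  set U' : Matrix (Fin (d + 1)) (Fin (d + 1)) ℤ := Matrix.of fun k j => U (e k) j with hU'
  have hbC' : ∀ k, (b ᵥ* C') k = (b ᵥ* Cm) (e k) := fun k => by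
    simp only [hC', Matrix.vecMul, dotProduct, Matrix.of_apply]
  have hlast : (b ᵥ* C') (Fin.last d) ≠ 0 := by rw [hbC', helast]; exact hbk₀
  have hmin' : ∀ k, (b ᵥ* C') k ≠ 0 → padicValInt 2 ((b ᵥ* C') (Fin.last d)) ≤ padicValInt 2 ((b ᵥ* C') k) := by
    intro k hk
    rw [hbC', helast]; rw [hbC'] at hk
    exact hk₀min (e k) (Finset.mem_filter.mpr ⟨Finset.mem_univ _, hk⟩)
  have hϑ'8 : ∀ k, 3 ≤ padicValRat 2 (ϑ' k - 1) := fun k => hϑ8 (e k)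
  have hϑ'pos : ∀ k, 0 < ϑ' k := fun k => hϑpos (e k)
  have hU'ϑ : ∀ k, ϑ' k ^ N = ∏ j, (α j ^ 2) ^ U' k j := fun k => hUϑ (e k)
  have hα2 : ∀ j, (0 : ℚ) < α j ^ 2 := fun j => by have := hα0 j; positivity
  have hϑ'ind : ∀ μ : Fin (d + 1) → ℤ, ∏ k, ϑ' k ^ μ k = 1 → μ = 0 := by
    intro μ hμ
    have h1 : ∏ i, ϑ i ^ (μ ∘ e.symm) i = 1 := by
      rw [← Equiv.prod_comp e (fun i => ϑ i ^ (μ ∘ e.symm) i)]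
      simpa [Function.comp, Equiv.symm_apply_apply] using hμ
    have h0 := hϑind _ h1
    funext k
    have := congrFun h0 (e k)
    simpa [Function.comp, Equiv.symm_apply_apply] using this
  have hαo' : ∀ j, α j ^ 2 = ∏ k, ϑ' k ^ C' j k := by
    intro j; rw [hαo j]; exact (Equiv.prod_comp e (fun i => ϑ i ^ Cm j i)).symm
  have hU'C' : U' * C' = (N : ℤ) • (1 : Matrix (Fin (d + 1)) (Fin (d + 1)) ℤ) := by
    rw [hU', hC']
    ext k k'
    rw [submatrix_mul_submatrix_apply U Cm e k k', hUC]
    simp only [Matrix.smul_apply, Matrix.one_apply, smul_eq_mul, e.injective.eq_iff]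
  have hC'U' : C' * U' = (N : ℤ) • (1 : Matrix (Fin (d + 1)) (Fin (d + 1)) ℤ) := by
    rw [hU', hC']
    ext j l
    rw [submatrix_mul_submatrix_apply' U Cm e j l, hCU]
  have hU'col : ∀ j, ∑ k, |U' k j| ≤ ((d + 1 : ℕ) : ℤ) * N := by
    intro j
    have := hUcol j
    rw [← Equiv.sum_comp e (fun i => |U i j|)] at this
    simpa only [hU', Matrix.of_apply] using this
  have hC'bnd : ∀ j k, |C' j k| ≤ (((d + 1) ! : ℕ) : ℤ) * N := fun j k => by
    simp only [hC', Matrix.of_apply]; exact hCbnd j (e k)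
  have hhϑ' : ∀ k, Height.logHeight₁ (ϑ' k) ≤ 2 * ∑ j, max 1 (Height.logHeight₁ (α j)) := fun k => hhϑ (e k)
  -- the record's supply
  set Ucol : Fin (d + 1) → ℕ := fun j => (d + 1) * N with hUcoldef
  have hUcol1 : ∀ j, ∑ k, |U' k j| ≤ (Ucol j : ℤ) := fun j => by rw [hUcoldef]; push_cast; exact hU'col j
  have hUcol2 : ∀ j, (Ucol j : ℤ) ≤ (d + 1 : ℕ) * N := fun j => by rw [hUcoldef]; push_cast; exact le_rfl
  obtain ⟨σ, Bv, Bv₀, H, L₀, B, S₀, X, D₀', D', hnum, hΛ, hX, hT, hD₀, hD, hrecord⟩ :=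
    hrec α b V Vmax W hα hind hV hV1 hVmax hb hW hW1 hneg ϑ' C' U' N Ucol hϑ'8 hlast hmin' hϑ'pos hNpos hU'ϑ hα2
      hϑ'ind hαo' hU'C' hC'U' hNle' hUcol1 hUcol2 hC'bnd hhϑ'
  -- the set-up's saturation datum and the END hypotheses
  have hdetU' : (satDataOf d ϑ' (b ᵥ* C') hϑ'8 hlast hmin' (fun j => α j ^ 2) hα2 hϑ'pos U' N hNpos hU'ϑ).U.det ≠ 0 := by
    intro h0
    have := congrArg Matrix.det hU'C'
    rw [Matrix.det_mul, Matrix.det_smul, Matrix.det_one, mul_one, Fintype.card_fin] at this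
    change U'.det = 0 at h0
    rw [h0, zero_mul] at this
    exact pow_ne_zero _ hNz this.symm
  have hbU' : (b ᵥ* C') ᵥ* U' = (N : ℤ) • b := by
    rw [Matrix.vecMul_vecMul, hC'U', Matrix.vecMul_smul, Matrix.vecMul_one]
  have hbU : (ofData d ϑ' (b ᵥ* C') hϑ'8 hlast hmin').ball ᵥ*
      (satDataOf d ϑ' (b ᵥ* C') hϑ'8 hlast hmin' (fun j => α j ^ 2) hα2 hϑ'pos U' N hNpos hU'ϑ).U =
      ((satDataOf d ϑ' (b ᵥ* C') hϑ'8 hlast hmin' (fun j => α j ^ 2) hα2 hϑ'pos U' N hNpos hU'ϑ).N : ℤ) • b := by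
    have hball : (ofData d ϑ' (b ᵥ* C') hϑ'8 hlast hmin').ball = b ᵥ* C' :=
      ofData_ball ϑ' (b ᵥ* C') hϑ'8 hlast hmin'
    rw [hball]
    exact hbU'
  have hK : ∀ κ : Fin ((ofData d ϑ' (b ᵥ* C') hϑ'8 hlast hmin').d + 1) → ℕ, (∃ j, ¬ 3 ∣ κ j) → ∀ γ : ℚ,
      ∏ j, (ofData d ϑ' (b ᵥ* C') hϑ'8 hlast hmin').toQ.all j ^ κ j ≠ γ ^ 3 := by
    change ∀ κ : Fin (d + 1) → ℕ, (∃ j, ¬ 3 ∣ κ j) → ∀ γ : ℚ,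
      ∏ j, (ofData d ϑ' (b ᵥ* C') hϑ'8 hlast hmin').toQ.all j ^ κ j ≠ γ ^ 3
    rw [ofData_all]
    refine KummerBasisChange.kummerNat_of_kummerInt 3 ϑ' fun ψ hψ k => ?_
    obtain ⟨γ, hγ⟩ := hψ
    have h1 : ∏ i, ϑ i ^ (ψ ∘ e.symm) i = γ ^ 3 := by
      rw [← Equiv.prod_comp e (fun i => ϑ i ^ (ψ ∘ e.symm) i)]
      simpa [Function.comp, Equiv.symm_apply_apply] using hγ
    have := hϑK3 _ γ h1 (e k)
    simpa [Function.comp, Equiv.symm_apply_apply] using this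
  -- a pivot for the END
  obtain ⟨j₀, hbj₀⟩ : ∃ j₀, b j₀ ≠ 0 := by
    by_contra h0
    push Not at h0
    exact hb (funext h0)
  have hout := frameOutputReal_of_numericsRASat σ _ Bv Bv₀ Ucol hnum hΛ hK b hbU hdetU' j₀ hX hT hD₀ hD
  -- independence of `ξⱼ = (αⱼ²)^{1/N}`
  have hα2ind : ∀ μ : Fin (d + 1) → ℤ, ∏ j, (α j ^ 2) ^ μ j = 1 → μ = 0 := by
    intro μ hμ
    have h2 : ∏ j, α j ^ (2 * μ j) = 1 := by
      calc ∏ j, α j ^ (2 * μ j) = ∏ j, (α j ^ 2) ^ μ j := prod_congr rfl fun j _ => by rw [zpow_mul]; norm_cast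
        _ = 1 := hμ
    have := hind _ h2
    funext j
    have hj := congr_fun this j
    simp only [Pi.zero_apply, mul_eq_zero, OfNat.ofNat_ne_zero, false_or] at hj
    exact hj
  have hNinv : ((N : ℝ))⁻¹ ≠ 0 := inv_ne_zero (by exact_mod_cast hNpos.ne')
  have hindξ := GenThreeEndReal.hind_units_of_rpow_rat (fun j => α j ^ 2) hα2 hα2ind hNinv
  refine ⟨_, j₀, D₀', S₀, X, D', fun ψ hψ => hindξ ψ ?_, hbj₀, hout, hrecord⟩
  convert hψ using 2 with j _
  rfl


end TwoSetup

end Summit.ABC.StewartYu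

end
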